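import Summits.HodgeConjecture.CorCM.DecicWeil23MultiHodgeOfMarkman
import Summits.HodgeConjecture.CorCM.DecicWeil23TripleHodgeOfMarkman
import Mathlib.LinearAlgebra.Dimension.Constructions
import HarnessLib

/-!
# COR-CM — the INDEPENDENCE CRITERION is automatic for at most THREE pairwise distinct `(2,3)`-types: the generic DECIC-MULTI
# theorem supersedes the `≤ 3 values` family theorems of gens 22–23

Cell `pub-hodgecm2` (COR-CM), seat b30 gen 24 (2026-08-22); count-neutral own lane DECIC-MULTI.  Theorems only; no definition, no
named fact of its own, no `sorry`.  HONEST FRAMING: the Hodge-conjecture statements are CONDITIONAL on the single displayed named fact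
`HodgeTheory.Markman2025_weilClasses_algebraic_hyperbolicSixfold` (arXiv:2502.03415 Thm 1.5.1, unrefereed); `HC_CM` is not asserted.

* §0 **`IndepPos.le_four`, `le_four_of_hInd`** — the criterion bounds the number of types: `r ≤ 4` (an injective `ℤ`-linear map
  `ℤ^{r+1} → ℤ⁵`); so the sixfold/tenfold method covers families with at most FOUR distinct types (`r = 4`:
  `CorCM/DecicWeil23MultiQuadHodgeOfMarkman`).
* §1 `hInd_of_indepPos` — frame ⟹ intrinsic: `IndepPos P` for a frame reading of the types gives the intrinsic criterion `hInd`
  of `CorCM/DecicWeil23MultiHodgeOfMarkman` (the converse transport is `indepPos_of_frameM` there).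
* §2 the solves: `indepPos_inPos` (the two normal positions of gen 22's `Census/DecicWeil23Pair`, `omega`), `indepPos_inPosT` (the
  eight shapes of `Census/DecicWeil23Triple`, from gen 23's `solveT`), `indepPos_single` (one column of weight two).
* §3 **`hInd_one`, `hInd_two`, `hInd_three`** — for ONE `(2,3)`-type, TWO distinct, THREE pairwise distinct `(2,3)`-types of a decic
  `K ⊇ i(k)` the intrinsic independence criterion HOLDS (frames `exists_frame₅` / `exists_frameD` / `exists_frameT`).
* §4 **`hodgeConjectureFor_of_avDominatedBy_family_le₃_of_markman_indep`** — gen 23's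
  `DecicWeil23Triple.hodgeConjectureFor_of_avDominatedBy_family_le₃_of_markmanT_h2T` RE-DERIVED from the generic family theorem
  `DecicWeil23Multi.hodgeConjectureFor_of_avDominatedBy_family_of_markman_indep` (lists of length `1`, `2`, `3`): any finite family of
  CM abelian fivefolds over `K` whose `(2,3)`-types take at most three values, × `E^a`, everything dominated, `2`-transitive quintic
  part, mod Markman's sixfold theorem.
[cite: Markman2025SecantWeil, Thm 1.5.1] [cite: Shimura1998, §18.2 Lemma (i) and §6.1 Thm. 2 Cor.] [cite: MoonenZarhin1995Duke, Thm. 2.4]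
[cite: MumfordAV1970, §19]

## References
* [Markman2025SecantWeil] E. Markman, arXiv:2502.03415 (unrefereed), Thm 1.5.1.  [Shimura1998] G. Shimura, *Abelian varieties
  with CM and modular functions*, §18.2 Lemma (i), §6.1 Thm. 2 Cor.  [MoonenZarhin1995Duke] B. Moonen, Yu. Zarhin, Duke Math. J.
  77 (1995), Thm. 2.4.  [MumfordAV1970] D. Mumford, *Abelian Varieties*, §19.
-/

noncomputable section

open CategoryTheory CategoryTheory.Limits NumberField

namespace Summit.HodgeConjecture.CorCM.DecicWeil23Multi

open Literature.AlgebraicGeometry Literature.AlgebraicGeometry.Motives Literature.AlgebraicGeometry.HodgeTheory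
open Literature.AlgebraicGeometry.ComplexMultiplication (IsCMTypeRealisation)
open Literature.AlgebraicTopology.SingularHomology
open Summit.HodgeConjecture.CorCM.Census.DecicWeil23Multi (IndepPos)
open Summit.HodgeConjecture.CorCM.Census.DecicWeil23Pair (inPos)
open Summit.HodgeConjecture.CorCM.Census.DecicWeil23Triple (inPosT solveT)
open Summit.HodgeConjecture.CorCM.DecicWeil23Pair (exists_frame₅ exists_frameD card_filter_symm_true₅ mem_iff_of_reading₅)
open Summit.HodgeConjecture.CorCM.DecicWeil23Triple (exists_frameT)
open Summit.HodgeConjecture.CorCM.Domination (AVDominatedBy)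

open scoped Classical

/-! ## §0 At most four types -/

section Bound

variable {r : ℕ}

/-- **The independence criterion allows at most FOUR types**: `IndepPos P` makes `(w, t) ↦ (x ↦ w + Σ_{m ∋ x} t_m)` an injective
`ℤ`-linear map `ℤ^{r+1} → ℤ⁵`, so `r + 1 ≤ 5`. [folklore] -/
theorem _root_.Summit.HodgeConjecture.CorCM.Census.DecicWeil23Multi.IndepPos.le_four {P : Fin r → Fin 5 → Bool}
    (hind : IndepPos P) : r ≤ 4 := by
  let L : (Fin (r + 1) → ℤ) →ₗ[ℤ] (Fin 5 → ℤ) :=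
    { toFun := fun v x => v 0 + ∑ m : Fin r, (if P m x then v m.succ else 0)
      map_add' := fun v v' => by
        ext x
        simp only [Pi.add_apply]
        rw [Finset.sum_congr rfl fun m _ => show (if P m x then v m.succ + v' m.succ else 0) =
          (if P m x then v m.succ else 0) + (if P m x then v' m.succ else 0) by split_ifs <;> simp, Finset.sum_add_distrib]
        ring
      map_smul' := fun c v => by
        ext x
        simp only [Pi.smul_apply, smul_eq_mul, RingHom.id_apply]
        rw [mul_add, Finset.mul_sum]
        congr 1
        exact Finset.sum_congr rfl fun m _ => by split_ifs <;> simp }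
  have hL : Function.Injective L := by
    intro v v' h
    have key := hind (v 0 - v' 0) (fun m => v m.succ - v' m.succ) fun x => by
      have hx := congrFun h x
      simp only [L, LinearMap.coe_mk, AddHom.coe_mk] at hx
      rw [Finset.sum_congr rfl fun m _ => show (if P m x then v m.succ - v' m.succ else 0) =
        (if P m x then v m.succ else 0) - (if P m x then v' m.succ else 0) by split_ifs <;> simp, Finset.sum_sub_distrib]
      linarith
    ext j
    refine Fin.cases ?_ (fun m => ?_) j
    · linarith [key.1]
    · linarith [key.2 m]
  have h := LinearMap.finrank_le_finrank_of_injective hL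
  rw [Module.finrank_fin_fun, Module.finrank_fin_fun] at h
  omega

end Bound

/-! ## §1 Frame ⟹ intrinsic -/

section Transport

variable {K : Type} [Field K] {k : Type} [Field k] {r : ℕ}
  {e : (K →+* ℂ) ≃ Fin 5 × Bool} {P : Fin r → Fin 5 → Bool} {i : k →+* K} {τ : k →+* ℂ} {Φ : Fin r → CMType K}

/-- **Frame ⟹ intrinsic independence**: if the types read as `s ∈ Φ_m ⟺ (e s).2 = P m (e s).1` in a frame with `(e s).2 = [s ∘ i = τ]`
and `IndepPos P`, then `w + Σ_{m : s ∈ Φ_m} t_m = 0` for all `s` over `τ` forces `w = t = 0` (evaluate at `s = e⁻¹(x, +)`). [folklore] -/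
theorem hInd_of_indepPos (he_sign : ∀ s, (e s).2 = true ↔ s.comp i = τ)
    (hread : ∀ (m : Fin r) (s : K →+* ℂ), s ∈ (Φ m).1 ↔ (e s).2 = P m (e s).1) (hind : IndepPos P) (w : ℤ) (t : Fin r → ℤ)
    (h : ∀ s : K →+* ℂ, s.comp i = τ → w + ∑ m : Fin r, (if s ∈ (Φ m).1 then t m else 0) = 0) : w = 0 ∧ ∀ m, t m = 0 := by
  refine hind w t fun x => ?_
  have hs : (e.symm (x, true)).comp i = τ := (he_sign _).1 (by rw [Equiv.apply_symm_apply])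
  have key := h _ hs
  rw [Finset.sum_congr rfl fun m _ => show (if e.symm (x, true) ∈ (Φ m).1 then t m else 0) = if P m x then t m else 0 by
    rw [hread, Equiv.apply_symm_apply]
    by_cases hx : P m x = true
    · rw [hx, if_pos rfl, if_pos rfl]
    · rw [if_neg (fun h' => hx h'.symm), if_neg hx]] at key
  exact key

end Transport

/-! ## §2 The solves -/

/-- **Two distinct types** (gen 22's normal positions `{0,1}` and `{1,2}` / `{3,2}`): the columns `𝟙, 𝟙_{I_0}, 𝟙_{I_1}` are independent.
[cite: MoonenZarhin1995Duke, Thm. 2.4] -/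
theorem indepPos_inPos (c : Bool) : IndepPos (inPos c) := by
  intro w t h
  have h0 := h 0; have h1 := h 1; have h2 := h 2; have h3 := h 3; have h4 := h 4
  simp only [Fin.sum_univ_two, inPos] at h0 h1 h2 h3 h4
  refine ⟨?_, fun m => ?_⟩
  · cases c <;> simp at h0 h1 h2 h3 h4 <;> omega
  · fin_cases m <;> cases c <;> simp at h0 h1 h2 h3 h4 ⊢ <;> omega

/-- **Three pairwise distinct types** (the eight shapes of `Census/DecicWeil23Triple`): the columns `𝟙, 𝟙_{I_0}, 𝟙_{I_1}, 𝟙_{I_2}` are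
independent (gen 23's `solveT`). [cite: MoonenZarhin1995Duke, Thm. 2.4] -/
theorem indepPos_inPosT (c : Fin 8) : IndepPos (inPosT c) := by
  intro w t h
  obtain ⟨hw, h₀, h₁, h₂⟩ := solveT c w (t 0) (t 1) (t 2) fun x => by
    have hx := h x
    rw [Fin.sum_univ_three] at hx
    linarith
  refine ⟨hw, fun m => ?_⟩
  fin_cases m
  exacts [h₀, h₁, h₂]

/-- **One type**: a single column of weight two and the constant column are independent (a point off `I` gives `w = 0`, a point
of `I` gives `t = 0`). [folklore] -/
theorem indepPos_single {P : Fin 1 → Fin 5 → Bool} (hP : ((Finset.univ : Finset (Fin 5)).filter fun a => P 0 a = true).card = 2) :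
    IndepPos P := by
  intro w t h
  have h' : ∀ x : Fin 5, w + (if P 0 x then t 0 else 0) = 0 := fun x => by
    have hx := h x
    rw [Fin.sum_univ_one] at hx
    exact hx
  -- a point off `I`
  have hoff : ∃ x : Fin 5, ¬ P 0 x = true := by
    by_contra hno
    push Not at hno
    have h5 : ((Finset.univ : Finset (Fin 5)).filter fun a => P 0 a = true).card = 5 := by
      rw [Finset.filter_true_of_mem fun a _ => hno a, Finset.card_univ, Fintype.card_fin]
    omega
  obtain ⟨x, hx⟩ := hoff
  have hw : w = 0 := by have := h' x; rwa [if_neg hx, add_zero] at this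
  -- a point of `I`
  obtain ⟨y, hy⟩ := Finset.card_pos.1 (by rw [hP]; norm_num :
    0 < ((Finset.univ : Finset (Fin 5)).filter fun a => P 0 a = true).card)
  have hy' : P 0 y = true := (Finset.mem_filter.1 hy).2
  refine ⟨hw, fun m => ?_⟩
  rw [Fin.fin_one_eq_zero m]
  have := h' y
  rwa [if_pos hy', hw, zero_add] at this

/-! ## §3 The intrinsic criterion holds for one, two and three pairwise distinct types -/

section Intrinsic

variable {K : Type} [Field K] [NumberField K] {k : Type} [Field k] [NumberField k]

/-- **ONE `(2,3)`-type satisfies the independence criterion.** [folklore] -/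
theorem hInd_one (h10 : Module.finrank ℚ K = 10) (h2 : Module.finrank ℚ k = 2) (i : k →+* K) {τ : k →+* ℂ}
    (hττ : ComplexEmbedding.conjugate τ ≠ τ) (hk : ∀ σ : k →+* ℂ, σ = τ ∨ σ = ComplexEmbedding.conjugate τ)
    (Φ₁ : CMType K) (h₁ : (Finset.univ.filter fun s : K →+* ℂ => s.comp i = τ ∧ s ∈ Φ₁.1).card = 2) (w : ℤ) (t : Fin 1 → ℤ)
    (h : ∀ s : K →+* ℂ, s.comp i = τ → w + ∑ m : Fin 1, (if s ∈ ((![Φ₁] : Fin 1 → CMType K) m).1 then t m else 0) = 0) :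
    w = 0 ∧ ∀ m, t m = 0 := by
  obtain ⟨e, P, he_sign, -, hP, hread⟩ := exists_frameM h10 h2 i hττ hk (![Φ₁] : Fin 1 → CMType K)
  exact hInd_of_indepPos he_sign hread (indepPos_single (card_pos_of_frameM he_sign hP (fun m => by
    rw [Fin.fin_one_eq_zero m]; exact h₁) 0)) w t h

/-- **TWO DISTINCT `(2,3)`-types satisfy the independence criterion** (gen 22's two-type normal frame). [cite: Shimura1998, §18.2 Lemma (i)] -/
theorem hInd_two (h10 : Module.finrank ℚ K = 10) (h2 : Module.finrank ℚ k = 2) (i : k →+* K) {τ : k →+* ℂ}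
    (hττ : ComplexEmbedding.conjugate τ ≠ τ) (hk : ∀ σ : k →+* ℂ, σ = τ ∨ σ = ComplexEmbedding.conjugate τ)
    (Φ₁ Φ₂ : CMType K) (h₁ : (Finset.univ.filter fun s : K →+* ℂ => s.comp i = τ ∧ s ∈ Φ₁.1).card = 2)
    (h₂ : (Finset.univ.filter fun s : K →+* ℂ => s.comp i = τ ∧ s ∈ Φ₂.1).card = 2) (h₁₂ : Φ₁ ≠ Φ₂) (w : ℤ) (t : Fin 2 → ℤ)
    (h : ∀ s : K →+* ℂ, s.comp i = τ → w + ∑ m : Fin 2, (if s ∈ ((![Φ₁, Φ₂] : Fin 2 → CMType K) m).1 then t m else 0) = 0) :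
    w = 0 ∧ ∀ m, t m = 0 := by
  obtain ⟨e, c, he_sign, -, hr₁, hr₂⟩ := exists_frameD h10 h2 i hττ hk Φ₁ Φ₂ h₁ h₂ h₁₂
  exact hInd_of_indepPos (Φ := ![Φ₁, Φ₂]) (P := inPos c) he_sign
    (fun m => Fin.cases hr₁ (fun m' => Fin.cases hr₂ (fun l => l.elim0) m') m) (indepPos_inPos c) w t h

/-- **THREE PAIRWISE DISTINCT `(2,3)`-types satisfy the independence criterion** (gen 22's shape normal frame). [cite: Shimura1998, §18.2 Lemma (i)] -/
theorem hInd_three (h10 : Module.finrank ℚ K = 10) (h2 : Module.finrank ℚ k = 2) (i : k →+* K) {τ : k →+* ℂ}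
    (hττ : ComplexEmbedding.conjugate τ ≠ τ) (hk : ∀ σ : k →+* ℂ, σ = τ ∨ σ = ComplexEmbedding.conjugate τ)
    (Φ₁ Φ₂ Φ₃ : CMType K) (h₁ : (Finset.univ.filter fun s : K →+* ℂ => s.comp i = τ ∧ s ∈ Φ₁.1).card = 2)
    (h₂ : (Finset.univ.filter fun s : K →+* ℂ => s.comp i = τ ∧ s ∈ Φ₂.1).card = 2)
    (h₃ : (Finset.univ.filter fun s : K →+* ℂ => s.comp i = τ ∧ s ∈ Φ₃.1).card = 2)
    (h₁₂ : Φ₁ ≠ Φ₂) (h₁₃ : Φ₁ ≠ Φ₃) (h₂₃ : Φ₂ ≠ Φ₃) (w : ℤ) (t : Fin 3 → ℤ)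
    (h : ∀ s : K →+* ℂ, s.comp i = τ → w + ∑ m : Fin 3, (if s ∈ ((![Φ₁, Φ₂, Φ₃] : Fin 3 → CMType K) m).1 then t m else 0) = 0) :
    w = 0 ∧ ∀ m, t m = 0 := by
  obtain ⟨e, c, he_sign, -, hr₁, hr₂, hr₃⟩ := exists_frameT h10 h2 i hττ hk Φ₁ Φ₂ Φ₃ h₁ h₂ h₃ h₁₂ h₁₃ h₂₃
  exact hInd_of_indepPos (Φ := ![Φ₁, Φ₂, Φ₃]) (P := inPosT c) he_sign
    (fun m => Fin.cases hr₁ (fun m' => Fin.cases hr₂ (fun m'' => Fin.cases hr₃ (fun l => l.elim0) m'') m') m)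
    (indepPos_inPosT c) w t h

/-- **At most four types satisfy the intrinsic independence criterion**: if `hInd` holds for `Φ : Fin r → CMType K` then `r ≤ 4`
(read the types in a frame: `indepPos_of_frameM`, then `IndepPos.le_four`). [folklore] -/
theorem le_four_of_hInd {r : ℕ} (h10 : Module.finrank ℚ K = 10) (h2 : Module.finrank ℚ k = 2) (i : k →+* K) {τ : k →+* ℂ}
    (hττ : ComplexEmbedding.conjugate τ ≠ τ) (hk : ∀ σ : k →+* ℂ, σ = τ ∨ σ = ComplexEmbedding.conjugate τ)
    (Φ : Fin r → CMType K)
    (hInd : ∀ (w : ℤ) (t : Fin r → ℤ), (∀ s : K →+* ℂ, s.comp i = τ → w + ∑ m : Fin r, (if s ∈ (Φ m).1 then t m else 0) = 0) →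
      w = 0 ∧ ∀ m, t m = 0) : r ≤ 4 := by
  obtain ⟨e, P, he_sign, -, hP, -⟩ := exists_frameM h10 h2 i hττ hk Φ
  exact (indepPos_of_frameM he_sign hP hInd).le_four

end Intrinsic

/-! ## §4 The `≤ 3 values` family theorem, re-derived from the generic one -/

section Family

variable {K : Type} [Field K] [NumberField K] [IsCMField K] {k : Type} [Field k] [NumberField k] [IsCMField k]
  {n : ℕ} {Θ : Fin n → CMType K} {A : Fin n → AbelianVariety ℂ} {ι : ∀ j, 𝓞 K →+* End (A j)}
  {θ : ∀ j, K →+* Module.End ℂ (complexBetti (A j).X 1)}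
  {Ψ : CMType k} {E : AbelianVariety ℂ} {ιE : 𝓞 k →+* End E} {θE : k →+* Module.End ℂ (complexBetti E.X 1)}

/-- **THE FAMILY FORM FOR AT MOST THREE VALUES, from the generic theorem.**  `K ⊇ i(k)` ANY decic CM field over the imaginary
quadratic `k` with `Aut(ℂ)` `2`-transitive on the five embeddings over `τ`; `A_j ⊨ (K; Θ_j)` (`j < n`) CM abelian fivefolds of
`k`-signature `(2,3)` whose types all lie in `{Θ_{j₁}, Θ_{j₂}, Θ_{j₃}}` (coincidences allowed); `E ⊨ (k; Ψ ∋ τ)`: every `C` dominated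
by `E^a × ∏_j A_j` satisfies the Hodge conjecture, GIVEN ONLY Markman's hyperbolic-sixfold theorem — the independence criterion
being automatic for the list of distinct values (`hInd_one/two/three`).  Same statement as gen 23's
`DecicWeil23Triple.hodgeConjectureFor_of_avDominatedBy_family_le₃_of_markmanT_h2T`, now a corollary of
`hodgeConjectureFor_of_avDominatedBy_family_of_markman_indep`. [cite: Markman2025SecantWeil, Thm 1.5.1] [cite: Shimura1998, §6.1 Thm. 2 Cor.]
[cite: MumfordAV1970, §19] -/
theorem hodgeConjectureFor_of_avDominatedBy_family_le₃_of_markman_indep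
    (hM6 : Markman2025_weilClasses_algebraic_hyperbolicSixfold)
    (h10 : Module.finrank ℚ K = 10) (h2 : Module.finrank ℚ k = 2) (i : k →+* K)
    (hA : ∀ j, IsCMTypeRealisation (Θ j) (A j) (ι j) (θ j)) {τ : k →+* ℂ} (j₁ j₂ j₃ : Fin n)
    (h23₁ : (Finset.univ.filter fun s : K →+* ℂ => s.comp i = τ ∧ s ∈ (Θ j₁).1).card = 2)
    (h23₂ : (Finset.univ.filter fun s : K →+* ℂ => s.comp i = τ ∧ s ∈ (Θ j₂).1).card = 2)
    (h23₃ : (Finset.univ.filter fun s : K →+* ℂ => s.comp i = τ ∧ s ∈ (Θ j₃).1).card = 2)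
    (hpos : ∀ j, Θ j = Θ j₁ ∨ Θ j = Θ j₂ ∨ Θ j = Θ j₃)
    (h2T : ∀ x y : Fin 2 ↪ {s : K →+* ℂ // s.comp i = τ}, ∃ ρ : ℂ ≃+* ℂ, ∀ l : Fin 2, (ρ : ℂ →+* ℂ).comp (x l).1 = (y l).1)
    (hE : IsCMTypeRealisation Ψ E ιE θE) (hτΨ : τ ∈ Ψ.1) (a : ℕ)
    {C : AbelianVariety ℂ} (hC : AVDominatedBy C ((⨁ fun _ : Fin a => E).prod (⨁ A))) :
    HodgeConjectureFor C.dim C.X := by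
  have hττ : ComplexEmbedding.conjugate τ ≠ τ := QuarticCM.conjugate_ne τ
  have hk : ∀ σ : k →+* ℂ, σ = τ ∨ σ = ComplexEmbedding.conjugate τ := fun σ =>
    QuarticCM.eq_or_eq_conjugate_of_quadratic h2 τ σ
  by_cases h₁₂ : Θ j₁ = Θ j₂
  · by_cases h₁₃ : Θ j₁ = Θ j₃
    · -- one value
      refine hodgeConjectureFor_of_avDominatedBy_family_of_markman_indep hM6 h10 h2 i hA (![Θ j₁] : Fin 1 → CMType K)
        (fun m => by rw [Fin.fin_one_eq_zero m]; exact h23₁) (hInd_one h10 h2 i hττ hk (Θ j₁) h23₁) (fun j => ⟨0, ?_⟩) h2T hE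
        hτΨ a hC
      rcases hpos j with h | h | h
      exacts [h, h.trans h₁₂.symm, h.trans h₁₃.symm]
    · -- two values `Θ j₁, Θ j₃`
      refine hodgeConjectureFor_of_avDominatedBy_family_of_markman_indep hM6 h10 h2 i hA (![Θ j₁, Θ j₃] : Fin 2 → CMType K)
        (fun m => Fin.cases h23₁ (fun m' => Fin.cases h23₃ (fun l => l.elim0) m') m) (hInd_two h10 h2 i hττ hk _ _ h23₁ h23₃ h₁₃)
        (fun j => ?_) h2T hE hτΨ a hC
      rcases hpos j with h | h | h
      exacts [⟨0, h⟩, ⟨0, h.trans h₁₂.symm⟩, ⟨1, h⟩]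
  · by_cases h₁₃ : Θ j₁ = Θ j₃
    · -- two values `Θ j₁, Θ j₂`
      refine hodgeConjectureFor_of_avDominatedBy_family_of_markman_indep hM6 h10 h2 i hA (![Θ j₁, Θ j₂] : Fin 2 → CMType K)
        (fun m => Fin.cases h23₁ (fun m' => Fin.cases h23₂ (fun l => l.elim0) m') m) (hInd_two h10 h2 i hττ hk _ _ h23₁ h23₂ h₁₂)
        (fun j => ?_) h2T hE hτΨ a hC
      rcases hpos j with h | h | h
      exacts [⟨0, h⟩, ⟨1, h⟩, ⟨0, h.trans h₁₃.symm⟩]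
    · by_cases h₂₃ : Θ j₂ = Θ j₃
      · -- two values `Θ j₁, Θ j₂ = Θ j₃`
        refine hodgeConjectureFor_of_avDominatedBy_family_of_markman_indep hM6 h10 h2 i hA (![Θ j₁, Θ j₂] : Fin 2 → CMType K)
          (fun m => Fin.cases h23₁ (fun m' => Fin.cases h23₂ (fun l => l.elim0) m') m) (hInd_two h10 h2 i hττ hk _ _ h23₁ h23₂ h₁₂)
          (fun j => ?_) h2T hE hτΨ a hC
        rcases hpos j with h | h | h
        exacts [⟨0, h⟩, ⟨1, h⟩, ⟨1, h.trans h₂₃.symm⟩]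
      · -- three pairwise distinct values
        refine hodgeConjectureFor_of_avDominatedBy_family_of_markman_indep hM6 h10 h2 i hA (![Θ j₁, Θ j₂, Θ j₃] : Fin 3 → CMType K)
          (fun m => Fin.cases h23₁ (fun m' => Fin.cases h23₂ (fun m'' => Fin.cases h23₃ (fun l => l.elim0) m'') m') m)
          (hInd_three h10 h2 i hττ hk _ _ _ h23₁ h23₂ h23₃ h₁₂ h₁₃ h₂₃) (fun j => ?_) h2T hE hτΨ a hC
        rcases hpos j with h | h | h
        exacts [⟨0, h⟩, ⟨1, h⟩, ⟨2, h⟩]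

end Family

end Summit.HodgeConjecture.CorCM.DecicWeil23Multi

end
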